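import Summits.CriticalPhenomena.PercolationContinuityZ3.Theorems.Transplant.SkelTubeLevels
import Summits.CriticalPhenomena.PercolationContinuityZ3.Theorems.Transplant.KNLevelsStepIII
import Summits.CriticalPhenomena.PercolationContinuityZ3.Theorems.Transplant.KNLevelsPacking
import Summits.CriticalPhenomena.PercolationContinuityZ3.Theorems.Transplant.BoxProdZ2SeedGeom
import HarnessLib

/-!
# L5.5a (generic design-(D) re-typing) — the ABSTRACT seed kit of a window level: from a seed REGION `S x ∋ y x` and a face `U x`
# attached to every candidate contact `x`, the `KNLevels.SData` of the window level and Kozma–Nitzan's Step-III axioms `KNLevels.SHyp`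
# (SHEAR-SCOPE §3.9 L5.5, the "reshape" item; src `BoxProdZ2SeedKitDefs` §3 / `BoxProdZ2SeedKit` §3)

builds on p205010 (kernel theorem, internal audit signed; external expert review pending) — nothing in this file uses p205010.
Lane `prim-bschramm`, seat `prim-bschramm-p1` (gen 7); helper file (`--supports stmt-CriticalPhenomena-4575 --as helper`).

Why this is a RESHAPE and not a port (lane INBOX 2026-08-20, p1-g7 18:34:54Z design flag; ruling p3-g4 18:39:38Z (A) "adopt";
refuter p5-g4 18:45:34Z "concur").  The Step-III axioms force every seed edge to have an endpoint in `B⟨j⟩` (`SHyp.touch`, used in (19)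
to keep seeds off `wireSet (region j)`) and both in `B⟨j+1⟩` (`within`), and Step V's `hSseed` keeps seeds off `wireSet S`, `S ⊇` the
cubes = planar depth `≥ 1` in the product (`kitSeed_notMem_wireSet` for `T ⊆ Icc (Lo+1) (Hi−1)`).  So product seeds live at planar depths
`{−1, 0, 1}` with at least one endpoint at depth `0` — fine there because FIBRE EDGES ARE `φ`-FLAT (`fibSet` spreads at depth `0`).
WITNESS on `H₃ = Cay(a^±, b^±)`, `φ = (a, b)`, right edges `(a,b,c) → (a±1,b,c)`, `(a,b,c) → (a,b±1,c±a)`: at a face vertex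
`y = (Hi₁, b₀, c₀)` away from the corners the component of `y` in the graph of LEGAL edges (endpoint depths `∈ {(−1,0),(0,0),(0,1)}`) is
`{(Hi₁+e, b₀+k, c₀+k·Hi₁) : e ∈ {−1,0,1}, k ∈ ℤ}` — ONE fibre value over each planar point (`b`-steps stay at depth `0` but shear `c`
by `Hi₁`; the commutator needs a depth-`1`–depth-`1` or depth-`(−1)`–depth-`(−1)` edge).  Hence `conn` (`x ↔` every `u ∈ face x` through
seed edges) forces `|face x ∩ φ⁻¹(q)| ≤ 1`: no fibre-fat face, so no Lemma-9 cube face (a `cylBall` quarter-piece) can sit behind a contact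
with depth-`0` seeds.  (Near corners the commutator IS legal — both coordinates at depth `0` — but contacts are everywhere on the faces.)
THE RESHAPE ('thick seed slab'): `seed(x) := {s(x,y)} ∪ edgesIn G (cylBallFin t ℓ_s R′) ∪ {s(u⁺,u) : u ∈ U(x)}`, `y` the contact's neighbour
in `B⟨j⟩`, `t` the `step`-vertex with `φ t = φ y − ℓ_s σ e_i`, so the cylinder `φ⁻¹(φ t + Λ_{ℓ_s})` spans inward depths `[0, 2ℓ_s]` of `B⟨j⟩`
(`touch` automatic), connected by (κ)+frames, fibre-fat by the type-uniform radius `cylRadMax` (p5-g4); the cube behind `x` sits from depth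
`2ℓ_s + 1` on (`ℓ_s := M+1`); far contacts (`fd > R − r₀`) get the product's edge-contact remedy (`face := {y}` joins the rim target, loss =
the collar estimate; `BoxProdZ2Collar`).  THIS FILE is the constructor substitution that does not depend on those constants: the generic seed
is the edge set of a connected, fibre-fat REGION `S x ∋ y x` inside `B⟨j⟩` behind the contact, plus the contact edge and the rungs into the
face; `SkelSeedSlab` instantiates `S x := cylBallFin …`.  This file is the constructor substitution that does not depend on those constants: it turns ANY assignment
`x ↦ (y x, S x, U x)` with
  `G.Adj x (y x)`, `y x ∈ S x ⊆ B⟨j⟩`, `U x ⊆ B⟨j⟩`, `S x ∪ U x ⊆ B_G(x, rs)`, `S x` connected from `y x` inside itself (`PathIn`), every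
  `u ∈ U x` adjacent to `S x`, `|S x| ≤ cS`, `|U x| ≤ cU`
(`Skel.KitOK`) into `Skel.kitSData` and proves `KNLevels.SHyp` for the window level data `Skel.winLData` (`shyp_kit`), together with the
two facts Steps IV–V consume: every seed pair lies in `B_G(x, rs)` (`seed_subset_graphBall`) and seeds avoid the pairs of any vertex set
missing `{x} ∪ S x` (`seed_notMem_wireSet`).  Far ("edge-of-ball") contacts are the special case `S x = U x = {y x}` (seed = the
contact edge, face = `{y x}` — the product's edge-contact remedy, `BoxProdZ2Collar`).
Contents: §1 `inNbr`; §2 `KitGeom` (`y`, `S`, `U`), `KitGeom.seed`, `mem_seed_cases`, `KitOK`; §3 `kitSData` (`K = ∂^{out}_{winGraph} B⟨j⟩`,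
`pick = apartSel` over graph balls of radius `2 rs`, `N = k (Δ+1)^{2rs}`, `sB = 1 + Δ cS + cS cU`); §4 `seed_notMem_wireSet`, **`shyp_kit`**.

[cite: KozmaNitzan2024, §4 Lemma 10, p. 19 (Step III, seeds; "the seeds are independent"), p. 21 (U(P)) — the ℤ^d model]
[cite: GrimmettPercolation1999, §7.2]
-/

noncomputable section

open scoped Classical

namespace Summit.CriticalPhenomena.PercolationContinuityZ3.Theorems

namespace Transplant

namespace Skel

open Literature.Probability.Percolation Literature.Probability.LatticeModels SimpleGraph KNLevels
open Literature.Barriers.CriticalPhenomena (graphBall graphBall_finite mem_graphBall_self graphBall_mono)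
open BoxProdZ2 (ballFin mem_ballFin card_ballFin_le)

variable {V : Type} (G : SimpleGraph V) [G.LocallyFinite]

/-! ## §1 A chosen inner neighbour of an outer-boundary vertex of a window -/

variable {G} in
/-- **The inner neighbour** of an outer-boundary vertex `x` of the window `Win w₀ P R` in the window graph: a `G`-neighbour of `x` in the
ball with skeleton coordinate in `P` (a choice; `x` itself off the outer boundary). [folklore] -/
def inNbr (Φ : PlanarSkeletonConc G) (w₀ : V) (R : ℕ) (P : Finset (Site 2)) (x : V) : V :=
  if h : x ∈ outerBoundary (winGraph G w₀ R) (Φ.Win w₀ P R) then Classical.choose ((mem_outerBoundary_win_iff Φ).1 h).2.2 else x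

variable {G} in
/-- Specification of the inner neighbour: adjacent to `x`, in the ball, skeleton coordinate in `P` (so it lies in the window).
[folklore] -/
theorem inNbr_spec (Φ : PlanarSkeletonConc G) {w₀ : V} {R : ℕ} {P : Finset (Site 2)} {x : V}
    (hx : x ∈ outerBoundary (winGraph G w₀ R) (Φ.Win w₀ P R)) :
    G.Adj x (inNbr Φ w₀ R P x) ∧ inNbr Φ w₀ R P x ∈ graphBall G w₀ R ∧ Φ.φ (inNbr Φ w₀ R P x) ∈ P := by
  rw [inNbr, dif_pos hx]
  exact Classical.choose_spec ((mem_outerBoundary_win_iff Φ).1 hx).2.2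

variable {G} in
/-- The inner neighbour lies in the window. [folklore] -/
theorem inNbr_mem_Win (Φ : PlanarSkeletonConc G) {w₀ : V} {R : ℕ} {P : Finset (Site 2)} {x : V}
    (hx : x ∈ outerBoundary (winGraph G w₀ R) (Φ.Win w₀ P R)) : inNbr Φ w₀ R P x ∈ Φ.Win w₀ P R :=
  (Φ.mem_Win).2 (inNbr_spec Φ hx).2

/-! ## §2 Seed geometries and their seeds -/

/-- **Seed geometry** attached to vertices: an inner neighbour `y x`, a seed region `S x` (a finite vertex set whose internal edges are
seed edges) and a face `U x` (the relay candidates of Step IV). [cite: KozmaNitzan2024, §4 p. 19 (seeds), p. 21 (U(P))] -/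
structure KitGeom (V : Type) where
  /-- the inner neighbour of a contact -/
  y : V → V
  /-- the seed region of a contact -/
  S : V → Finset V
  /-- the face behind a contact -/
  U : V → Finset V

namespace KitGeom

variable (κ : KitGeom V)

/-- **The seed of `x`**: the contact edge `x — y x`, all edges of `G` inside the region `S x`, and the rungs (edges of `G`) from `S x`
into the face `U x`. [cite: KozmaNitzan2024, §4 p. 19 ("Call a given plaquette a seed if …")] -/
def seed (x : V) : Finset (Sym2 V) :=
  {s(x, κ.y x)} ∪ edgesIn G (κ.S x) ∪ ((κ.S x ×ˢ κ.U x).filter fun q => G.Adj q.1 q.2).image fun q => s(q.1, q.2)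

variable {G}

/-- The contact edge is a seed edge. [folklore] -/
theorem contactEdge_mem_seed (x : V) : s(x, κ.y x) ∈ κ.seed G x := by
  exact Finset.mem_union.2 (Or.inl (Finset.mem_union.2 (Or.inl (Finset.mem_singleton_self _))))

/-- Edges inside the region are seed edges. [folklore] -/
theorem edgesIn_subset_seed (x : V) : edgesIn G (κ.S x) ⊆ κ.seed G x := by
  intro e he
  simp only [seed, Finset.mem_union]
  exact Or.inl (Or.inr he)

/-- Rungs are seed edges. [folklore] -/
theorem rung_mem_seed {x v u : V} (hv : v ∈ κ.S x) (hu : u ∈ κ.U x) (hvu : G.Adj v u) : s(v, u) ∈ κ.seed G x := by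
  simp only [seed, Finset.mem_union, Finset.mem_image, Finset.mem_filter, Finset.mem_product]
  exact Or.inr ⟨(v, u), ⟨⟨hv, hu⟩, hvu⟩, rfl⟩

/-- **Case analysis of a seed edge**: the contact edge, an edge inside the region, or a rung. [folklore] -/
theorem mem_seed_cases {x : V} {e : Sym2 V} (he : e ∈ κ.seed G x) :
    e = s(x, κ.y x) ∨ e ∈ edgesIn G (κ.S x) ∨ ∃ v ∈ κ.S x, ∃ u ∈ κ.U x, G.Adj v u ∧ e = s(v, u) := by
  simp only [seed, Finset.mem_union, Finset.mem_singleton, Finset.mem_image, Finset.mem_filter, Finset.mem_product] at he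
  rcases he with (h | h) | ⟨q, ⟨⟨hq1, hq2⟩, hadj⟩, rfl⟩
  · exact Or.inl h
  · exact Or.inr (Or.inl h)
  · exact Or.inr (Or.inr ⟨q.1, hq1, q.2, hq2, hadj, rfl⟩)

/-- Every seed edge has an endpoint in `{x} ∪ S x` and both endpoints in `{x, y x} ∪ S x ∪ U x`. [folklore] -/
theorem exists_mem_of_mem_seed {x : V} {e : Sym2 V} (he : e ∈ κ.seed G x) :
    (∃ z ∈ e, z = x ∨ z ∈ κ.S x) ∧ ∀ z ∈ e, z = x ∨ z = κ.y x ∨ z ∈ κ.S x ∨ z ∈ κ.U x := by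
  rcases κ.mem_seed_cases he with rfl | h | ⟨v, hv, u, hu, -, rfl⟩
  · exact ⟨⟨x, Sym2.mem_mk_left _ _, Or.inl rfl⟩, fun z hz => by
      rcases Sym2.mem_iff.1 hz with rfl | rfl
      · exact Or.inl rfl
      · exact Or.inr (Or.inl rfl)⟩
  · rw [mem_edgesIn_iff] at h
    induction e using Sym2.ind with
    | h a b =>
      exact ⟨⟨a, Sym2.mem_mk_left _ _, Or.inr (h.2 a (Sym2.mem_mk_left _ _))⟩,
        fun z hz => Or.inr (Or.inr (Or.inl (h.2 z hz)))⟩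
  · exact ⟨⟨v, Sym2.mem_mk_left _ _, Or.inr hv⟩, fun z hz => by
      rcases Sym2.mem_iff.1 hz with rfl | rfl
      · exact Or.inr (Or.inr (Or.inl hv))
      · exact Or.inr (Or.inr (Or.inr hu))⟩

end KitGeom

/-- **`|E(F)| ≤ Δ · |F|`** for a graph with degrees `≤ Δ` (p3's `BoxProdZ2.card_edgesIn_le_degree`, restated to keep the imports of the
generic layer light). [folklore] -/
theorem card_edgesIn_le_mul {Δ : ℕ} (hΔ : ∀ w, G.degree w ≤ Δ) (F : Finset V) : (edgesIn G F).card ≤ Δ * F.card := by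
  calc (edgesIn G F).card ≤ (edgesTouching G F).card := Finset.card_le_card (edgesIn_subset_edgesTouching F)
    _ ≤ ∑ x ∈ F, (G.incidenceFinset x).card := Finset.card_biUnion_le
    _ ≤ ∑ _x ∈ F, Δ := Finset.sum_le_sum fun x _ => by rw [SimpleGraph.card_incidenceFinset_eq_degree]; exact hΔ x
    _ = Δ * F.card := by rw [Finset.sum_const, smul_eq_mul, mul_comm]

variable {G}

/-- **An open region carries open paths**: if every edge of `G` inside `F` is open in `ω`, a `G`-path inside `F` is an open path.
[folklore] -/
theorem reachable_of_pathIn_of_edgesIn {F : Finset V} {ω : BondConfig V} (hω : ∀ e ∈ edgesIn G F, e ∈ ω) {a b : V}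
    (h : PathIn G (↑F : Set V) a b) : (openGraph ω).Reachable a b := by
  obtain ⟨ha, hp⟩ := h
  induction hp with
  | refl => exact SimpleGraph.Reachable.refl _
  | @tail u v huv hv ih =>
    have hu : u ∈ (↑F : Set V) := (show PathIn G (↑F : Set V) a u from ⟨ha, huv⟩).right_mem
    refine ih.trans (SimpleGraph.Adj.reachable ?_)
    rw [openGraph_adj]
    refine ⟨hω _ ?_, hv.1.ne⟩
    rw [mem_edgesIn_iff]
    refine ⟨(SimpleGraph.mem_edgeSet (G := G)).2 hv.1, fun w hw => ?_⟩
    rcases Sym2.mem_iff.1 hw with rfl | rfl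
    · exact Finset.mem_coe.1 hu
    · exact Finset.mem_coe.1 hv.2

variable (Φ : PlanarSkeletonConc G)

/-- **The hypotheses on a seed geometry at the window level `j`** (`K = ∂^{out}_{winGraph} B⟨j⟩`): the inner neighbour is adjacent to
the contact and lies in the region; region and face lie in `B⟨j⟩` and in the graph ball `B_G(x, rs)`; the region is connected from the
inner neighbour inside itself; every face vertex has a neighbour in the region; sizes `≤ cS`, `≤ cU`.
[cite: KozmaNitzan2024, §4 p. 19 (Step III)] -/
structure KitOK (w₀ : V) (R : ℕ) (lo hi : Site 2) (j rs cS cU : ℕ) (κ : KitGeom V) : Prop where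
  adj : ∀ x ∈ outerBoundary (winGraph G w₀ R) (winLevel Φ w₀ R lo hi j), G.Adj x (κ.y x)
  y_mem : ∀ x ∈ outerBoundary (winGraph G w₀ R) (winLevel Φ w₀ R lo hi j), κ.y x ∈ κ.S x
  S_sub : ∀ x ∈ outerBoundary (winGraph G w₀ R) (winLevel Φ w₀ R lo hi j), κ.S x ⊆ winLevel Φ w₀ R lo hi j
  U_sub : ∀ x ∈ outerBoundary (winGraph G w₀ R) (winLevel Φ w₀ R lo hi j), κ.U x ⊆ winLevel Φ w₀ R lo hi j
  S_ball : ∀ x ∈ outerBoundary (winGraph G w₀ R) (winLevel Φ w₀ R lo hi j), ∀ v ∈ κ.S x, v ∈ graphBall G x rs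
  U_ball : ∀ x ∈ outerBoundary (winGraph G w₀ R) (winLevel Φ w₀ R lo hi j), ∀ u ∈ κ.U x, u ∈ graphBall G x rs
  S_path : ∀ x ∈ outerBoundary (winGraph G w₀ R) (winLevel Φ w₀ R lo hi j), ∀ v ∈ κ.S x, PathIn G (↑(κ.S x) : Set V) (κ.y x) v
  U_adj : ∀ x ∈ outerBoundary (winGraph G w₀ R) (winLevel Φ w₀ R lo hi j), ∀ u ∈ κ.U x, ∃ v ∈ κ.S x, G.Adj v u
  S_card : ∀ x ∈ outerBoundary (winGraph G w₀ R) (winLevel Φ w₀ R lo hi j), (κ.S x).card ≤ cS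
  U_card : ∀ x ∈ outerBoundary (winGraph G w₀ R) (winLevel Φ w₀ R lo hi j), (κ.U x).card ≤ cU

/-! ## §3 The seed data of a window level and the Step-III axioms -/

/-- The separation neighbourhoods (graph balls of radius `2 rs`) contain their centre. [folklore] -/
theorem center_mem_ballFin' (rs : ℕ) (x : V) : x ∈ ballFin G x (2 * rs) := BoxProdZ2.center_mem_ballFin G x _
/-- The separation neighbourhoods are symmetric. [folklore] -/
theorem ballFin_symm' (rs : ℕ) (x y : V) (h : y ∈ ballFin G x (2 * rs)) : x ∈ ballFin G y (2 * rs) := by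
  rw [mem_ballFin] at h ⊢
  exact (BoxProdZ2.mem_graphBall_comm G).1 h

/-- `(Δ+1)^{2rs}` is positive. [folklore] -/
theorem pow_succ_pos' (Δ rs : ℕ) : 0 < (Δ + 1) ^ (2 * rs) := by positivity
/-- **The seed data of the window level `j`**: candidate contacts = the outer boundary of `B⟨j⟩` in the window graph, the seeds and faces of
the geometry `κ`, the greedy selection of `k` contacts pairwise at graph distance `> 2 rs` among `N = k (Δ+1)^{2 rs}`, and the seed size
bound `1 + Δ cS + cS cU`.  Generic twin of `BoxProdZ2.kitSData`. [cite: KozmaNitzan2024, §4 p. 19 (Step III)] -/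
def kitSData (w₀ : V) (R : ℕ) (lo hi : Site 2) (j : ℕ) (κ : KitGeom V) (rs cS cU k : ℕ) : SData V where
  K := outerBoundary (winGraph G w₀ R) (winLevel Φ w₀ R lo hi j)
  seed := κ.seed G
  face := κ.U
  pick := apartSel (fun x => ballFin G x (2 * rs)) (center_mem_ballFin' rs) (ballFin_symm' rs) (pow_succ_pos' Φ.Δ rs)
    (fun x => card_ballFin_le G Φ.degree_le x (2 * rs)) k
  N := k * (Φ.Δ + 1) ^ (2 * rs)
  k := k
  sB := 1 + Φ.Δ * cS + cS * cU

/-- The candidate contacts of `kitSData`. [folklore] -/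
@[simp] theorem kitSData_K (w₀ : V) (R : ℕ) (lo hi : Site 2) (j : ℕ) (κ : KitGeom V) (rs cS cU k : ℕ) :
    (kitSData Φ w₀ R lo hi j κ rs cS cU k).K = outerBoundary (winGraph G w₀ R) (winLevel Φ w₀ R lo hi j) := rfl

/-- The seeds of `kitSData`. [folklore] -/
@[simp] theorem kitSData_seed (w₀ : V) (R : ℕ) (lo hi : Site 2) (j : ℕ) (κ : KitGeom V) (rs cS cU k : ℕ) :
    (kitSData Φ w₀ R lo hi j κ rs cS cU k).seed = κ.seed G := rfl

/-- The faces of `kitSData`. [folklore] -/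
@[simp] theorem kitSData_face (w₀ : V) (R : ℕ) (lo hi : Site 2) (j : ℕ) (κ : KitGeom V) (rs cS cU k : ℕ) :
    (kitSData Φ w₀ R lo hi j κ rs cS cU k).face = κ.U := rfl

/-- The selection of `kitSData` is a subset. [folklore] -/
theorem kitSData_pick_subset (w₀ : V) (R : ℕ) (lo hi : Site 2) (j : ℕ) (κ : KitGeom V) (rs cS cU k : ℕ) (c : Finset V) :
    (kitSData Φ w₀ R lo hi j κ rs cS cU k).pick c ⊆ c :=
  apartSel_subset (fun x => ballFin G x (2 * rs)) (center_mem_ballFin' rs) (ballFin_symm' rs) (pow_succ_pos' Φ.Δ rs)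
    (fun x => card_ballFin_le G Φ.degree_le x (2 * rs)) k c

/-- The selection of `kitSData` on large sets: `k` elements, pairwise at graph distance `> 2 rs`. [folklore] -/
theorem kitSData_pick_spec (w₀ : V) (R : ℕ) (lo hi : Site 2) (j : ℕ) (κ : KitGeom V) (rs cS cU k : ℕ) {c : Finset V}
    (hc : k * (Φ.Δ + 1) ^ (2 * rs) ≤ c.card) :
    ((kitSData Φ w₀ R lo hi j κ rs cS cU k).pick c).card = k ∧
      ∀ x ∈ (kitSData Φ w₀ R lo hi j κ rs cS cU k).pick c, ∀ x' ∈ (kitSData Φ w₀ R lo hi j κ rs cS cU k).pick c,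
        x ≠ x' → x' ∉ ballFin G x (2 * rs) :=
  have h := apartSel_spec (fun x => ballFin G x (2 * rs)) (center_mem_ballFin' rs) (ballFin_symm' rs) (pow_succ_pos' Φ.Δ rs)
    (fun x => card_ballFin_le G Φ.degree_le x (2 * rs)) hc
  ⟨h.2.1, h.2.2⟩

/-! ## §4 Seed geometry: ball containment, avoidance, disjointness; the Step-III axioms -/

section OK

variable {Φ}
variable {w₀ : V} {R : ℕ} {lo hi : Site 2} {j rs cS cU : ℕ} {κ : KitGeom V}

/-- An outer-boundary vertex of a window level lies in the ball. [folklore] -/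
theorem mem_graphBall_of_mem_K {x : V} (hx : x ∈ outerBoundary (winGraph G w₀ R) (winLevel Φ w₀ R lo hi j)) :
    x ∈ graphBall G w₀ R :=
  ((mem_outerBoundary_win_iff Φ).1 hx).1

/-- **Seeds avoid the pairs of any vertex set missing `{x} ∪ S x`** (the form in which Step V's `hSseed` and the locality of `F_x` are
discharged: the cubes live in the part of the shell that the seed regions do not enter). [cite: KozmaNitzan2024, §4 p. 21 ("Q ⊆ S")] -/
theorem seed_notMem_wireSet {x : V} {T : Set V} (hxT : x ∉ T) (hST : ∀ v ∈ κ.S x, v ∉ T) {e : Sym2 V} (he : e ∈ κ.seed G x) :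
    e ∉ wireSet T := by
  intro hw
  obtain ⟨⟨z, hz, hzx⟩, -⟩ := κ.exists_mem_of_mem_seed he
  have hzT : z ∈ T := hw.1 z hz
  rcases hzx with rfl | hzS
  · exact hxT hzT
  · exact hST z hzS hzT

variable (hκ : KitOK Φ w₀ R lo hi j rs cS cU κ)
include hκ

/-- **Every endpoint of a seed edge lies in `B_G(x, rs)`** (the contact itself at distance `0`). [folklore] -/
theorem seed_subset_graphBall {x : V} (hx : x ∈ outerBoundary (winGraph G w₀ R) (winLevel Φ w₀ R lo hi j)) {e : Sym2 V}
    (he : e ∈ κ.seed G x) : ∀ z ∈ e, z ∈ graphBall G x rs := by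
  intro z hz
  rcases (κ.exists_mem_of_mem_seed he).2 z hz with rfl | rfl | h | h
  · exact mem_graphBall_self G _ rs
  · exact hκ.S_ball _ hx _ (hκ.y_mem _ hx)
  · exact hκ.S_ball _ hx _ h
  · exact hκ.U_ball _ hx _ h

/-- **Contacts at graph distance `> 2 rs` have disjoint seeds.** [cite: KozmaNitzan2024, §4 p. 19 ("the seeds are independent")] -/
theorem disjoint_seed_of_not_mem_ballFin {x x' : V} (hx : x ∈ outerBoundary (winGraph G w₀ R) (winLevel Φ w₀ R lo hi j))
    (hx' : x' ∈ outerBoundary (winGraph G w₀ R) (winLevel Φ w₀ R lo hi j)) (hfar : x' ∉ ballFin G x (2 * rs)) :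
    Disjoint (κ.seed G x) (κ.seed G x') := by
  rw [Finset.disjoint_left]
  intro e he he'
  induction e using Sym2.ind with
  | h a b =>
    have ha := seed_subset_graphBall hκ hx he a (Sym2.mem_mk_left a b)
    have ha' := seed_subset_graphBall hκ hx' he' a (Sym2.mem_mk_left a b)
    refine hfar ((mem_ballFin G).2 ?_)
    have h := BoxProdZ2.mem_graphBall_add G ha ((BoxProdZ2.mem_graphBall_comm G).1 ha')
    rwa [two_mul]

/-- **The Step-III axioms for the abstract seed kit of a window level** (generic twin of `BoxProdZ2.shyp_kit`): for every window level
data `L = winLData Φ w₀ R lo hi o Sfin`, `KNLevels.SHyp L j (kitSData …)` — candidate contacts ⊇ every contact set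
(`LData.Kont_subset`), seed edges are window-graph edges (all endpoints in the ball) inside `B⟨j+1⟩` (`winLevel_nest` for the contact,
`B⟨j⟩ ⊆ B⟨j+1⟩` for the rest) each meeting `B⟨j⟩`, at most `1 + Δ cS + cS cU` of them, an open seed joins `x` to every face vertex
(contact edge, a path inside the open region, a rung), and the greedy selection delivers `k` contacts with pairwise disjoint seeds.
[cite: KozmaNitzan2024, §4 p. 19 (Step III)] -/
theorem shyp_kit (o : V) (Sfin : Finset V) (k : ℕ) :
    SHyp (winLData Φ w₀ R lo hi o Sfin) j (kitSData Φ w₀ R lo hi j κ rs cS cU k) where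
  Kont_sub ω := by
    rw [kitSData_K]
    exact (winLData Φ w₀ R lo hi o Sfin).Kont_subset j ω
  edge x hx e he := by
    rw [kitSData_K] at hx
    rw [kitSData_seed] at he
    have hball : ∀ z ∈ e, z ∈ graphBall G w₀ R := by
      intro z hz
      rcases (κ.exists_mem_of_mem_seed he).2 z hz with rfl | rfl | h | h
      · exact mem_graphBall_of_mem_K (Φ := Φ) hx
      · exact winLevel_subset_graphBall Φ w₀ R lo hi j (hκ.S_sub _ hx (hκ.y_mem _ hx))
      · exact winLevel_subset_graphBall Φ w₀ R lo hi j (hκ.S_sub _ hx h)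
      · exact winLevel_subset_graphBall Φ w₀ R lo hi j (hκ.U_sub _ hx h)
    have hG : e ∈ G.edgeSet := by
      rcases κ.mem_seed_cases he with rfl | h | ⟨v, -, u, -, hvu, rfl⟩
      · exact (SimpleGraph.mem_edgeSet (G := G)).2 (hκ.adj _ hx)
      · exact ((mem_edgesIn_iff).1 h).1
      · exact (SimpleGraph.mem_edgeSet (G := G)).2 hvu
    induction e using Sym2.ind with
    | h a b =>
      rw [SimpleGraph.mem_edgeSet] at hG ⊢
      exact (winGraph_adj G).2 ⟨hG, hball a (Sym2.mem_mk_left a b), hball b (Sym2.mem_mk_right a b)⟩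
  within x hx e he z hz := by
    rw [kitSData_K] at hx
    rw [kitSData_seed] at he
    rw [winLData_X]
    have hmono := winLevel_monotone Φ w₀ R lo hi (Nat.le_succ j)
    rcases (κ.exists_mem_of_mem_seed he).2 z hz with rfl | rfl | h | h
    · exact winLevel_nest Φ w₀ R lo hi j hx
    · exact hmono (hκ.S_sub _ hx (hκ.y_mem _ hx))
    · exact hmono (hκ.S_sub _ hx h)
    · exact hmono (hκ.U_sub _ hx h)
  touch x hx e he := by
    rw [kitSData_K] at hx
    rw [kitSData_seed] at he
    rw [winLData_X]
    rcases κ.mem_seed_cases he with rfl | h | ⟨v, hv, u, -, -, rfl⟩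
    · exact ⟨κ.y x, Sym2.mem_mk_right _ _, hκ.S_sub _ hx (hκ.y_mem _ hx)⟩
    · induction e using Sym2.ind with
      | h a b => exact ⟨a, Sym2.mem_mk_left a b, hκ.S_sub _ hx (((mem_edgesIn_iff).1 h).2 a (Sym2.mem_mk_left a b))⟩
    · exact ⟨v, Sym2.mem_mk_left _ _, hκ.S_sub _ hx hv⟩
  card_le x hx := by
    rw [kitSData_K] at hx
    simp only [kitSData_seed, KitGeom.seed]
    calc ({s(x, κ.y x)} ∪ edgesIn G (κ.S x) ∪
            ((κ.S x ×ˢ κ.U x).filter fun q => G.Adj q.1 q.2).image fun q => s(q.1, q.2)).card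
        ≤ ({s(x, κ.y x)} ∪ edgesIn G (κ.S x)).card +
            (((κ.S x ×ˢ κ.U x).filter fun q => G.Adj q.1 q.2).image fun q => s(q.1, q.2)).card := Finset.card_union_le _ _
      _ ≤ (1 + Φ.Δ * cS) + cS * cU := by
          refine Nat.add_le_add ((Finset.card_union_le _ _).trans (Nat.add_le_add (by simp) ?_)) ?_
          · exact (card_edgesIn_le_mul G Φ.degree_le _).trans (Nat.mul_le_mul_left _ (hκ.S_card _ hx))
          · calc (((κ.S x ×ˢ κ.U x).filter fun q => G.Adj q.1 q.2).image fun q => s(q.1, q.2)).card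
                ≤ ((κ.S x ×ˢ κ.U x).filter fun q => G.Adj q.1 q.2).card := Finset.card_image_le
              _ ≤ (κ.S x ×ˢ κ.U x).card := Finset.card_filter_le _ _
              _ = (κ.S x).card * (κ.U x).card := Finset.card_product _ _
              _ ≤ cS * cU := Nat.mul_le_mul (hκ.S_card _ hx) (hκ.U_card _ hx)
      _ = 1 + Φ.Δ * cS + cS * cU := rfl
  conn x hx ω hω u hu := by
    rw [kitSData_K] at hx
    rw [kitSData_seed] at hω
    rw [kitSData_face] at hu
    obtain ⟨v, hv, hvu⟩ := hκ.U_adj _ hx u hu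
    -- the contact edge
    have h1 : (openGraph ω).Adj x (κ.y x) := by
      rw [openGraph_adj]
      exact ⟨hω (Finset.mem_coe.2 (κ.contactEdge_mem_seed x)), (hκ.adj _ hx).ne⟩
    -- the open region
    have h2 : (openGraph ω).Reachable (κ.y x) v :=
      reachable_of_pathIn_of_edgesIn (fun e he => hω (Finset.mem_coe.2 (κ.edgesIn_subset_seed x he))) (hκ.S_path _ hx v hv)
    -- the rung
    have h3 : (openGraph ω).Adj v u := by
      rw [openGraph_adj]
      exact ⟨hω (Finset.mem_coe.2 (κ.rung_mem_seed hv hu hvu)), hvu.ne⟩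
    exact h1.reachable.trans (h2.trans h3.reachable)
  pick_sub c := kitSData_pick_subset Φ w₀ R lo hi j κ rs cS cU k c
  pick_card c hcK hc := (kitSData_pick_spec Φ w₀ R lo hi j κ rs cS cU k hc).1
  pick_disj c hcK hc := by
    refine pairwiseDisjoint_apartSel (fun x => ballFin G x (2 * rs)) (center_mem_ballFin' rs) (ballFin_symm' rs)
      (pow_succ_pos' Φ.Δ rs) (fun x => card_ballFin_le G Φ.degree_le x (2 * rs)) hc fun x hx x' hx' hfar => ?_
    rw [kitSData_K] at hcK
    exact disjoint_seed_of_not_mem_ballFin hκ (hcK hx) (hcK hx') hfar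

end OK

end Skel

end Transplant

end Summit.CriticalPhenomena.PercolationContinuityZ3.Theorems

end
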